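import Summits.Parity.BatemanHorn.Theorems.RoughValueTransportBalancedSemiprimeLayerDegreeLeTwo
import Summits.Parity.BatemanHorn.Theses.RoughValueTransport
import HarnessLib

/-!
# Line `rough-relaxed-divisor-sieve` — checked skeleton for the crux `BalancedSemiprimeLayer`
(item stmt-Parity-9469, route `RoughValueTransport`, sub-problem Parity/BatemanHorn)
— LEAD'S RESHAPE r1 (prover-line-stmt-Parity-9469-2, third seat, 2026-08-16)

Crux (by name, concluded by `BalancedSemiprimeLayer_of` below):
`Summit.Parity.BatemanHorn.Theses.RoughValueTransport.BalancedSemiprimeLayer` — for every Bateman–Horn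
system `f` of `k` polynomials and every `ε > 0` there is `δ ∈ (0, 1/4]` with, eventually in `x`,
`Φ_f(x, δ) ≤ P_f(x) + ε·x/(log x)^k`, where `Φ_f(x, δ)` counts the `1 ≤ n ≤ x` all of whose values
`fⱼ(n)` are positive and free of primes `< x^{deg fⱼ (1−δ)/2}` and `P_f = polyPrimeCount f`.

## The line and why it is reshaped (planner skeleton `Lines/rough-relaxed-divisor-sieve.lean`, 6 stubs)

The planner's composition is a DEGREE DISPATCH: `coordLayerThin_of_parts` sends a coordinate of degree
`≤ 2` through S1 `stub_coordLayerThin_of_typeI` (the lever: relax both balanced primes, sieve the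
divisor-weighted pair family in dimension `k+1`) fed by S2 `stub_windowMertens`, S3 `stub_typeIPairLevel`,
S4 `stub_pairLevelForms` / S5 `stub_pairLevelForms_of_DFI` (the DFI/Tóth level-form Type-I supplier), and a
coordinate of degree `≥ 3` through the declared RESIDUAL S6 `stub_coordLayerThin_highDegree`; then
`systemLayerConclusion_of_coordLayerThin` (split `ε/k`, least `δ`) and the `k = 0` slice give the crux.

State of the tree when this seat opened (2026-08-16T06:00Z): the merge partner of this line,
`smooth-modulus-twisted-hooley` (triage r1-1/2/3: "same lever, different Type-I supplier"), is BUILT AND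
LANDED — `Theorems/RoughValueTransportDefs` (p72142), `…QuadraticDictionary` (p72470), `…LinearLayer`
(p73627), `…UniformTypeI` (p74271), `…TwistedHooley` (p74670, + `Literature…QuadraticRootsTwistedHooley`
p74417), `…QuadraticSieve*` (p74679–p76614), `…DegreeLeTwo` (p78616), `…Split` (p83112).  Consequently the
degree-`≤ 2` branch of THIS line's dispatch is an unconditional tree theorem
(`Split.coordLayerThin_of_natDegree_le_two`; for whole systems `layerConclusion_of_natDegree_le_two`), and
`balancedSemiprimeLayer_iff_higherLayer` (p78616; `⟹` is `Negative.higherLayer_of_balancedSemiprimeLayer`,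
p75295) makes the crux EQUIVALENT to the degree-`≥ 3` residual.  Building S1–S5 (a second proof of the
degree-`≤ 2` theorem, ≈ 5–7 kloc, S4 unprinted) cannot remove one `sorry` from the crux; S6 IS the crux.

RESHAPE r1 therefore keeps the composition (degree dispatch → crux by name) and discharges its
degree-`≤ 2` branch by IMPORT: the registered stub set is {`stub_coordLayerThin_highDegree`}, now stated in
UNFOLDED route vocabulary — verbatim the right-hand side of the landed
`Split.balancedSemiprimeLayer_iff_higherLayer_unfolded` (the `LayerHigher` text the planner is asked to
file), so that the disprover's `-- Targets`, a consult, and the planner all read ONE statement — and the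
composition is the landed `Split.balancedSemiprimeLayer_of_higherLayer_unfolded` (= `stub_transfer`:
glue `Φ_f ≤ P_f + Σᵢ Eᵢ`, `ε/k`, least `δ`, `k = 0` slice, degree-`≤ 2` coordinates by the landed stubs).
The planner's S1 remains a valid degree-blind lever; what has no supplier in degree `≥ 3` is its Type-I
input `TypeIPairLevel` (moduli `m·e ≥ x^{d(1−δ)/2} ≥ x^{9/8} > x` = number of terms).

## Disproof.lean (gen 2 rev 6, 2026-08-16T05:22Z) — read; what applies to the one stub

`§8 Targets`: `stub_higherLayer : SURVIVES — open problem in both directions, crux-equivalent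
(Negative.HigherLayerNecessary p75295), relatively consistent (RVL ∧ SC ∧ BH ⇒ it, p70540), no cheap kill
(Negative.LargePrimeFactors p75976: a kill needs P⁺(∏_{n≤x} f(n)) ≥ x^{9/8} i.o. for a cubic, record
x^{1+10⁻⁵²})`.  The stub below is that statement verbatim (unfolded), so every finding transfers.  The
load-bearing hypotheses (`_false_without_notAssociated/irreducible/noFixedPrimeDivisor`) and the refuted
strengthenings (tolerance `(log x)^{−(k+1)}`, `∃δ∀ε`, fixed `δ = 1/4`, coordinatewise bound) are honoured:
the stub keeps joint roughness of the spectators, tolerance `x/(log x)^k`, order `∀ε∃δ`.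
-/

noncomputable section

namespace Summit.Parity.BatemanHorn.Cruxes.BalancedSemiprimeLayer.RoughRelaxedDivisorSieve

open Polynomial Filter Finset
open Literature.NumberTheory.Sieve
open Summit.Parity.BatemanHorn.Theses.RoughValueTransport (BalancedSemiprimeLayer)
open Summit.Parity.BatemanHorn.Cruxes.BalancedSemiprimeLayer.SmoothModulusTwistedHooley
  (CoordLayerThin stub_transfer stub_linearLayer stub_quadraticDictionary stub_quadraticSieve
    stub_uniformTypeI stub_twistedHooley DegreeLeTwo.coordLayerThin_quadratic_of_parts)
open Summit.Parity.BatemanHorn.Theorems.BalancedSemiprimeLayer.Negative (natDegree_pos_of_isBatemanHornSystem)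

/-! ### The registered stub (`sorry` lives ONLY here) -/

/-- **S6 `stub_coordLayerThin_highDegree` — RESIDUAL of the line, = the crux's degree-`≥ 3` residue
(`LayerHigher`), OPEN.**  For every Bateman–Horn system `f` of `k` polynomials, every coordinate `i` of
degree `≥ 3` and every `ε > 0` there is `δ ∈ (0, 1/4]` such that eventually in `x` the number of
`1 ≤ n ≤ x` that are JOINTLY rough to depth `δ` (every `fⱼ(n) > 0` and free of primes
`< x^{deg fⱼ (1−δ)/2}`) but have `fᵢ(n)` NOT prime is `≤ ε·x/(log x)^k`.  For `δ ≤ 1/4` these `n` have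
`fᵢ(n) = 1` or `fᵢ(n) = p₁p₂` with `x^{dᵢ(1−δ)/2} ≤ p₁ ≤ p₂` (balanced), and `p₁ ≥ x^{9/8} > x`.
Stated in route vocabulary: verbatim the right-hand side of
`Split.balancedSemiprimeLayer_iff_higherLayer_unfolded` (so it is EQUIVALENT to the crux, p78616/p75295),
and `CoordLayerThin f i` of `Theorems/RoughValueTransportDefs` unfolded.
Why open: every handle (k-dim sieve at level `< x`; switching to `p₁` or `p₂` as modulus; the line's
own divisor-pair `(k+1)`-dim sieve; cubic-field lattice levels; Nair–Tenenbaum; Hooley's `Δ`; larger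
sieve) needs divisor statistics of `fᵢ(n)`, `n ≤ x`, at scales `m ∈ (x, x^{dᵢ−1})` — power-saving
equidistribution of the roots of `fᵢ mod m` beyond the number of terms; in print only log-savings
(Hooley 1964) and level `x^{1+o(1)}` (Tenenbaum 1990; `x^{1+10⁻⁵²}` for `X³+2`).
`Literature.Barriers.Parity.FordMaynardLowLevel` (thin-set regime) records the absence of Type-I/II
information; it does not refute the statement (an upper bound).  Leans on: nothing available. -/
theorem stub_coordLayerThin_highDegree :
    ∀ (k : ℕ) (f : Fin k → Polynomial ℤ), Literature.NumberTheory.Sieve.IsBatemanHornSystem f →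
      ∀ i : Fin k, 3 ≤ (f i).natDegree → ∀ ε : ℝ, 0 < ε → ∃ δ : ℝ, 0 < δ ∧ δ ≤ 1 / 4 ∧
        ∀ᶠ x : ℕ in Filter.atTop,
          (((Finset.Icc 1 x).filter (fun n : ℕ => (∀ j, 0 < (f j).eval (n : ℤ) ∧
              ∀ p ∈ Finset.range ⌈(x : ℝ) ^ (((f j).natDegree : ℝ) * (1 - δ) / 2)⌉₊,
                p.Prime → ¬ ((p : ℤ) ∣ (f j).eval (n : ℤ))) ∧
              ¬ ((f i).eval (n : ℤ)).toNat.Prime)).card : ℝ) ≤ ε * (x : ℝ) / Real.log x ^ k := by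
  sorry

/-! ### The composition (sorry-free): degree dispatch, then the crux BY NAME -/

/-- The stub in the `CoordLayerThin` vocabulary of `Theorems/RoughValueTransportDefs` (definitional
unfolding; recorded so that workers of either line can cite it by name). -/
theorem coordLayerThin_of_three_le_natDegree {k : ℕ} {f : Fin k → ℤ[X]} (hf : IsBatemanHornSystem f)
    (i : Fin k) (hi : 3 ≤ (f i).natDegree) : CoordLayerThin f i :=
  stub_coordLayerThin_highDegree k f hf i hi

/-- **Degree dispatch** (the planner's `coordLayerThin_of_parts`, with its degree-`≤ 2` branch now the
LANDED stubs of the merge-partner line — `stub_linearLayer` (p73627) for degree `1`, and for degree `2`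
`DegreeLeTwo.coordLayerThin_quadratic_of_parts` fed by `stub_quadraticDictionary` (p72470),
`stub_quadraticSieve` (p76614), `stub_uniformTypeI` (p74271), `stub_twistedHooley` (p74670) — and its
degree-`≥ 3` branch the stub): every coordinate of every Bateman–Horn system has a thin layer.
(Same term as the landed `Split.coordLayerThin_of_higherLayer_system`, p83112.) -/
theorem coordLayerThin_of_parts {k : ℕ} {f : Fin k → ℤ[X]} (hf : IsBatemanHornSystem f) (i : Fin k) :
    CoordLayerThin f i := by
  have hpos := natDegree_pos_of_isBatemanHornSystem hf i
  rcases Nat.lt_trichotomy (f i).natDegree 2 with hlt | heq | hgt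
  · exact stub_linearLayer k f hf i (by omega)
  · exact DegreeLeTwo.coordLayerThin_quadratic_of_parts stub_quadraticDictionary stub_quadraticSieve
      k f hf i heq
      (stub_uniformTypeI (f i) heq (hf.irreducible i) (stub_twistedHooley (f i) heq (hf.irreducible i)))
  · exact coordLayerThin_of_three_le_natDegree hf i (by omega)

/-- **THE COMPOSITION.**  `BalancedSemiprimeLayer` BY NAME from the one registered stub, through the
landed transfer `stub_transfer` (p78616; re-typed in unfolded route vocabulary as
`Split.balancedSemiprimeLayer_of_higherLayer_unfolded`, p83112): gluing `Φ_f ≤ P_f + Σᵢ Eᵢ`, `ε/k` over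
the coordinates, least `δ` capped at `1/4`, `eventually_all`, the `k = 0` slice, and the degree-`≤ 2`
coordinates by the landed stubs of the merge-partner line (the dispatch above).  No `sorry` of its own;
`sorryAx` enters exactly through `stub_coordLayerThin_highDegree`. -/
theorem BalancedSemiprimeLayer_of : BalancedSemiprimeLayer :=
  stub_transfer stub_coordLayerThin_highDegree

end Summit.Parity.BatemanHorn.Cruxes.BalancedSemiprimeLayer.RoughRelaxedDivisorSieve
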